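import Literature.NumberTheory.EllipticCurves.QuadraticTwistPadicReduction
import Literature.NumberTheory.EllipticCurves.QuadraticTwistJInvariantProofs
import Literature.NumberTheory.EllipticCurves.QuadraticTwistProofs
import Literature.NumberTheory.EllipticCurves.LFunctionSmulProofs
import HarnessLib

/-!
# The local Euler factor of a quadratic twist by a unit, in odd residue characteristic

Let `R` be a discrete valuation ring with fraction field `K` and *finite residue field `k` of odd
characteristic* (`2 ∈ Rˣ`), `X / K` an elliptic curve and `d ∈ Rˣ` a unit. The quadratic twist
`X^{(d)}` (the tree's `WeierstrassCurve.quadraticTwist`) becomes isomorphic to `X` over the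
unramified extension `K(√d)`, and its local invariants are those of `X` "twisted by the quadratic
character of `k` at `d̄`":

* `isIntegral_quadraticTwist`, `isMinimal_quadraticTwist` — the twist of an integral (minimal)
  equation by a unit is integral (minimal): the explicit model
  `(0, d b₂/4, 0, d² b₄/2, d³ b₆/4)` has `c₄ ↦ d² c₄`, `Δ ↦ d⁶ Δ`, and minimality follows by
  twisting back (`(X^{(d)})^{(d)} = X^{(d²)} ≅ X`);
* `hasGoodReduction_quadraticTwist_iff`, `hasMultiplicativeReduction_quadraticTwist_iff`,
  `hasAdditiveReduction_quadraticTwist_iff` — the reduction type of a minimal equation is unchanged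
  (it only depends on `v(Δ)`, `v(c₄)`);
* `hasSplitMultiplicativeReduction_quadraticTwist_iff` — at a multiplicative place the twist is
  split iff (`d̄` is a square in `k`) ↔ (`X` is split): the discriminant of Mathlib's node-tangent
  polynomial is `−c₄ c₆ ≠ 0`, which the twist multiplies by `d⁵`;
* `reduction_quadraticTwist` and `card_sub_natCard_point_reduction_quadraticTwist` — at a good
  place the reduction of the twist is the twist of the reduction, so
  `q + 1 − #X̃^{(d)}(k) = χ(d̄) (q + 1 − #X̃(k))` (Knapp, *Elliptic Curves*, Prop. 12.10, the tree's
  `card_add_one_sub_natCard_point_quadraticTwist`);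
* `localPolynomial_quadraticTwist` — **Mathlib's local polynomial of the twist is
  `L_v(X^{(d)}, T) = L_v(X, χ(d̄) T)`**: with `L_v(X, T) = 1 − A T + B T²` one has
  `L_v(X^{(d)}, T) = 1 − χ(d̄) A T + B T²` (`χ(d̄) = ±1` the quadratic residue symbol of `d̄ ∈ kˣ`),
  and `localPowerSeries_quadraticTwist`, `localEulerFactor_quadraticTwist`: `1/L_v(X^{(d)}, T)` is
  the rescaling by `χ(d̄)` of `1/L_v(X, T)`.

This is the unramified-twist half of the classical statement "`a_𝔭(E ⊗ χ) = χ(𝔭) a_𝔭(E)` for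
`𝔭 ∤ cond χ`" (Silverman, *AEC* X.2 Prop. 2.4, X.5 Cor. 5.4, Exercise 10.16; the computation of
Knapp, *Elliptic Curves*, Prop. 12.10 at the good primes), here for Mathlib's
`WeierstrassCurve.localPolynomial` / `localEulerFactor` at every place of odd residue
characteristic, including the bad ones. Everything is proved; there are no new definitions or
named facts. It is the local input at the odd places `v ∤ p` of the comparison
`L(E^{(p*)}, s) = L(E ⊗ χ_p, s)` used for the Atkin–Lehner eigenvalue of the newform of a quadratic
twist (`RootNumberTwistProofs`).

## References

* J. H. Silverman, *The Arithmetic of Elliptic Curves*, GTM 106, 2nd ed. 2009, VII.1 Prop. 1.3,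
  VII.5 Prop. 5.1 (reduction types of minimal equations), X.2 Prop. 2.4, X.5 Cor. 5.4 (twists),
  App. C §16 (local factors).
* A. W. Knapp, *Elliptic Curves*, Math. Notes 40, Princeton UP 1993, Prop. 12.10 (PDF pp. 302–303).
-/

noncomputable section

open scoped Classical

open IsLocalRing IsDiscreteValuationRing IsDedekindDomain.HeightOneSpectrum Polynomial

namespace WeierstrassCurve

variable (R : Type*) [CommRing R] [IsDomain R] [IsDiscreteValuationRing R]
  {K : Type*} [Field K] [Algebra R K] [IsFractionRing R K]

/-! ### Units, and the explicit integral model of a unit twist -/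

section Integral

/-- `2 ≠ 0` in `K` when `2` is a unit of `R`. [folklore] -/
theorem two_ne_zero_of_isUnit_two (h2 : IsUnit (2 : R)) : (2 : K) ≠ 0 := by
  rw [← map_ofNat (algebraMap R K) 2]
  exact (map_ne_zero_iff _ (IsFractionRing.injective R K)).mpr h2.ne_zero

/-- A unit of `R` has valuation `1` in `K`. [folklore] -/
theorem valuation_algebraMap_units (u : Rˣ) :
    valuation K (maximalIdeal R) (algebraMap R K u) = 1 :=
  (valuation_eq_one_iff_notMem _).mpr fun h ↦ (IsLocalRing.mem_maximalIdeal _).mp h u.isUnit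

/-- A unit of `R` is non-zero in `K`. [folklore] -/
theorem algebraMap_units_ne_zero (u : Rˣ) : algebraMap R K u ≠ 0 :=
  (map_ne_zero_iff _ (IsFractionRing.injective R K)).mpr u.ne_zero

/-- A unit of `R` has non-zero residue. [folklore] -/
theorem residue_units_ne_zero (u : Rˣ) : residue R u ≠ 0 :=
  (IsLocalRing.residue_ne_zero_iff_isUnit _).mpr u.isUnit

/-- `Δ(X^{(d)}) = d⁶ Δ(X)` has the same valuation as `Δ(X)` for a unit `d`. [folklore] -/
theorem valuation_Δ_quadraticTwist [NeZero (2 : K)] (X : WeierstrassCurve K) (d : Rˣ) :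
    valuation K (maximalIdeal R) (X.quadraticTwist (algebraMap R K d)).Δ =
      valuation K (maximalIdeal R) X.Δ := by
  rw [quadraticTwist_Δ, map_mul, map_pow, valuation_algebraMap_units, one_pow, one_mul]

/-- `c₄(X^{(d)}) = d² c₄(X)` has the same valuation as `c₄(X)` for a unit `d`. [folklore] -/
theorem valuation_c₄_quadraticTwist [NeZero (2 : K)] (X : WeierstrassCurve K) (d : Rˣ) :
    valuation K (maximalIdeal R) (X.quadraticTwist (algebraMap R K d)).c₄ =
      valuation K (maximalIdeal R) X.c₄ := by
  rw [quadraticTwist_c₄, map_mul, map_pow, valuation_algebraMap_units, one_pow, one_mul]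

/-- For `X / K` integral with integral model `I`, `2 = w ∈ Rˣ` and `d ∈ R`, the `R`-equation
`(0, d b₂(I) w⁻², 0, d² b₄(I) w⁻¹, d³ b₆(I) w⁻²)` is an `R`-model of the twist `X^{(d)}`
(`= (0, d b₂/4, 0, d² b₄/2, d³ b₆/4)` over `K`). [folklore] -/
theorem baseChange_twistLift (X : WeierstrassCurve K) [IsIntegral R X] (w : Rˣ) (hw : (w : R) = 2)
    (d : R) :
    (⟨0, d * (X.integralModel R).b₂ * ↑w⁻¹ * ↑w⁻¹, 0, d ^ 2 * (X.integralModel R).b₄ * ↑w⁻¹,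
        d ^ 3 * (X.integralModel R).b₆ * ↑w⁻¹ * ↑w⁻¹⟩ : WeierstrassCurve R).baseChange K =
      X.quadraticTwist (algebraMap R K d) := by
  have h2 : algebraMap R K (w : R) = 2 := by rw [hw, map_ofNat]
  have h20 : (2 : K) ≠ 0 := two_ne_zero_of_isUnit_two R (K := K) (hw ▸ w.isUnit)
  have h40 : (4 : K) ≠ 0 := by
    rw [show (4 : K) = 2 * 2 by norm_num]
    exact mul_ne_zero h20 h20
  have hinv : algebraMap R K ((w⁻¹ : Rˣ) : R) = (2 : K)⁻¹ := by
    rw [← h2]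
    exact map_units_inv (algebraMap R K) w
  ext
  · simp [baseChange]
  · simp only [baseChange, map_a₂, quadraticTwist_a₂, map_mul, hinv, integralModel_b₂_eq]
    field_simp
    norm_num
  · simp [baseChange]
  · simp only [baseChange, map_a₄, quadraticTwist_a₄, map_mul, map_pow, hinv, integralModel_b₄_eq]
    field_simp
  · simp only [baseChange, map_a₆, quadraticTwist_a₆, map_mul, map_pow, hinv, integralModel_b₆_eq]
    field_simp
    norm_num

/-- The quadratic twist of an `R`-integral equation by `d ∈ R` is `R`-integral (`2 ∈ Rˣ`).
[folklore] -/
theorem isIntegral_quadraticTwist (X : WeierstrassCurve K) [IsIntegral R X] (h2 : IsUnit (2 : R))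
    (d : R) : IsIntegral R (X.quadraticTwist (algebraMap R K d)) := by
  obtain ⟨w, hw⟩ := h2
  exact ⟨_, (baseChange_twistLift R X w hw d).symm⟩

/-- The integral model of the twist is the explicit `R`-equation of `baseChange_twistLift`
(integral models are unique). [folklore] -/
theorem integralModel_quadraticTwist (X : WeierstrassCurve K) [IsIntegral R X] (w : Rˣ)
    (hw : (w : R) = 2) (d : R) [IsIntegral R (X.quadraticTwist (algebraMap R K d))] :
    (X.quadraticTwist (algebraMap R K d)).integralModel R =
      ⟨0, d * (X.integralModel R).b₂ * ↑w⁻¹ * ↑w⁻¹, 0, d ^ 2 * (X.integralModel R).b₄ * ↑w⁻¹,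
        d ^ 3 * (X.integralModel R).b₆ * ↑w⁻¹ * ↑w⁻¹⟩ :=
  integralModel_eq_of_baseChange_eq _ _ (baseChange_twistLift R X w hw d)

end Integral

/-! ### Minimality of the twist of a minimal equation (twisting back) -/

section Minimal

/-- For a minimal `X`, every integral equation `C • X` has `v(Δ(C • X)) ≥ v(Δ(X))`, i.e.
multiplicatively `|Δ(C • X)| ≤ |Δ(X)|` (Silverman, *AEC* VII.1, Definition of minimality).
[cite: SilvermanAEC2009, VII.1 Definition (PDF p. 165)] -/
theorem valuation_Δ_smul_le_of_isMinimal (X : WeierstrassCurve K) [hX : IsMinimal R X]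
    (C : VariableChange K) (hC : IsIntegral R (C • X)) :
    valuation K (maximalIdeal R) (C • X).Δ ≤ valuation K (maximalIdeal R) X.Δ := by
  haveI := hC
  have h : valuation_Δ_aux R (C • X) ≤ valuation_Δ_aux R ((1 : VariableChange K) • X) :=
    hX.val_Δ_maximal.le hC
  rwa [one_smul, ← Subtype.coe_le_coe, valuation_Δ_aux_eq_of_isIntegral,
    valuation_Δ_aux_eq_of_isIntegral] at h

/-- **The twist of a minimal equation by a unit is minimal** (`2 ∈ Rˣ`): if `C • X^{(d)}` is
integral then so is its twist `(C • X^{(d)})^{(d)} = C' • X^{(d²)} ≅ X` (`quadraticTwist_smul`,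
`quadraticTwist_quadraticTwist`, `exists_variableChange_smul_eq_quadraticTwist_sq`), an integral
equation of `X`, whence `v(Δ(C • X^{(d)})) = v(d⁶ Δ(C • X^{(d)})) ≥ v(Δ(X)) = v(Δ(X^{(d)}))` by
minimality of `X`. [folklore] -/
theorem isMinimal_quadraticTwist (X : WeierstrassCurve K) [IsMinimal R X] (h2 : IsUnit (2 : R))
    (d : Rˣ) : IsMinimal R (X.quadraticTwist (algebraMap R K d)) := by
  haveI : NeZero (2 : K) := ⟨two_ne_zero_of_isUnit_two R h2⟩
  haveI hYint : IsIntegral R (X.quadraticTwist (algebraMap R K d)) :=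
    isIntegral_quadraticTwist R X h2 d
  rw [isMinimal_iff]
  refine ⟨by simpa using hYint, fun C hC _ ↦ ?_⟩
  change IsIntegral R (C • X.quadraticTwist (algebraMap R K d)) at hC
  haveI := hC
  simp only [one_smul]
  rw [← Subtype.coe_le_coe, valuation_Δ_aux_eq_of_isIntegral, valuation_Δ_aux_eq_of_isIntegral]
  -- twist back
  haveI hback : IsIntegral R ((C • X.quadraticTwist (algebraMap R K d)).quadraticTwist
      (algebraMap R K d)) := isIntegral_quadraticTwist R _ h2 d
  obtain ⟨C'', hC''⟩ := X.exists_variableChange_smul_eq_quadraticTwist_sq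
    (algebraMap_units_ne_zero R (K := K) d)
  have heq : (C • X.quadraticTwist (algebraMap R K d)).quadraticTwist (algebraMap R K d) =
      ((⟨C.u, algebraMap R K d * C.r, 0, 0⟩ : VariableChange K) * C'') • X := by
    rw [quadraticTwist_smul, quadraticTwist_quadraticTwist, mul_smul, hC'', sq]
  have hle := valuation_Δ_smul_le_of_isMinimal R X _ (heq ▸ hback)
  rw [← heq, valuation_Δ_quadraticTwist] at hle
  rwa [valuation_Δ_quadraticTwist]

end Minimal

/-! ### Reduction types of the twist -/

section ReductionType

variable [NeZero (2 : K)] {X : WeierstrassCurve K} [IsMinimal R X] {d : Rˣ}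
  [IsMinimal R (X.quadraticTwist (algebraMap R K d))]

/-- Good reduction is unchanged by a unit twist (it only depends on `v(Δ)`).
[cite: SilvermanAEC2009, VII.5 Prop. 5.1(a)] -/
theorem hasGoodReduction_quadraticTwist_iff :
    (X.quadraticTwist (algebraMap R K d)).HasGoodReduction R ↔ X.HasGoodReduction R := by
  rw [hasGoodReduction_iff, hasGoodReduction_iff, valuation_Δ_quadraticTwist]
  exact and_congr_left' ⟨fun _ ↦ inferInstance, fun _ ↦ inferInstance⟩

/-- Multiplicative reduction is unchanged by a unit twist (it only depends on `v(Δ)`, `v(c₄)`).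
[cite: SilvermanAEC2009, VII.5 Prop. 5.1(b)] -/
theorem hasMultiplicativeReduction_quadraticTwist_iff :
    (X.quadraticTwist (algebraMap R K d)).HasMultiplicativeReduction R ↔
      X.HasMultiplicativeReduction R := by
  rw [hasMultiplicativeReduction_iff, hasMultiplicativeReduction_iff, valuation_Δ_quadraticTwist,
    valuation_c₄_quadraticTwist]
  exact and_congr_left' ⟨fun _ ↦ inferInstance, fun _ ↦ inferInstance⟩

/-- Additive reduction is unchanged by a unit twist (it only depends on `v(Δ)`, `v(c₄)`).
[cite: SilvermanAEC2009, VII.5 Prop. 5.1(c)] -/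
theorem hasAdditiveReduction_quadraticTwist_iff :
    (X.quadraticTwist (algebraMap R K d)).HasAdditiveReduction R ↔ X.HasAdditiveReduction R := by
  rw [hasAdditiveReduction_iff, hasAdditiveReduction_iff, valuation_Δ_quadraticTwist,
    valuation_c₄_quadraticTwist]
  exact and_congr_left' ⟨fun _ ↦ inferInstance, fun _ ↦ inferInstance⟩

end ReductionType

/-! ### Split versus non-split: the node-tangent discriminant -/

section Split

omit [IsDomain R] [IsDiscreteValuationRing R] in
/-- Over a field of characteristic `≠ 2`, a quadratic `a T² + b T + c` (`a ≠ 0`) splits iff its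
discriminant `b² − 4ac` is a square (quadratic formula; Mathlib `exists_quadratic_eq_zero`,
`discrim_eq_sq_of_quadratic_eq_zero`). [folklore] -/
theorem splits_quadratic_iff_isSquare_discrim {k : Type*} [Field k] [NeZero (2 : k)] {a b c : k}
    (ha : a ≠ 0) : Splits (C a * X ^ 2 + C b * X + C c) ↔ IsSquare (discrim a b c) := by
  constructor
  · intro h
    have hdeg : (C a * X ^ 2 + C b * X + C c).degree ≠ 0 := by
      rw [degree_quadratic ha]; decide
    obtain ⟨x, hx⟩ := h.exists_eval_eq_zero hdeg
    have hx' : a * (x * x) + b * x + c = 0 := by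
      simp only [eval_add, eval_mul, eval_C, eval_pow, eval_X] at hx
      linear_combination hx
    exact ⟨2 * a * x + b, by rw [discrim_eq_sq_of_quadratic_eq_zero hx']; ring⟩
  · rintro ⟨r, hr⟩
    obtain ⟨x, hx⟩ := exists_quadratic_eq_zero ha ⟨r, hr⟩
    refine Splits.of_natDegree_eq_two (natDegree_quadratic ha) (x := x) ?_
    simp only [eval_add, eval_mul, eval_C, eval_pow, eval_X]
    linear_combination hx

omit [IsDomain R] [IsDiscreteValuationRing R] in
/-- **The discriminant of the node-tangent polynomial** `c₄ T² + a₁c₄ T − (54 b₆ − 3 b₂ b₄ + a₂ c₄)`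
of Mathlib's `HasSplitMultiplicativeReduction` is `−c₄ c₆` (an identity in the `aᵢ` over any
commutative ring). [folklore] -/
theorem discrim_nodalTangents {S : Type*} [CommRing S] (W : WeierstrassCurve S) :
    discrim W.c₄ (W.a₁ * W.c₄) (-(54 * W.b₆ - 3 * W.b₂ * W.b₄ + W.a₂ * W.c₄)) = -(W.c₄ * W.c₆) := by
  simp only [discrim, b₂, b₄, b₆, c₄, c₆]
  ring

omit [IsDomain R] [IsDiscreteValuationRing R] in
/-- In a finite field of odd characteristic, for `x, y ≠ 0`: `xy` is a square iff (`x` is a square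
↔ `y` is a square) (the squares have index `2`; via the quadratic character). [folklore] -/
theorem isSquare_mul_iff_of_finite {k : Type*} [Field k] [Finite k]
    {x y : k} (hx : x ≠ 0) (hy : y ≠ 0) : IsSquare (x * y) ↔ (IsSquare x ↔ IsSquare y) := by
  haveI := Fintype.ofFinite k
  rw [← quadraticChar_one_iff_isSquare (mul_ne_zero hx hy), ← quadraticChar_one_iff_isSquare hx,
    ← quadraticChar_one_iff_isSquare hy, map_mul]
  rcases quadraticChar_dichotomy hx with h | h <;>
    rcases quadraticChar_dichotomy hy with h' | h' <;> simp [h, h']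

omit [IsDomain R] [IsDiscreteValuationRing R] in
/-- Multiplying by a non-zero square does not change squareness. [folklore] -/
theorem isSquare_mul_sq_iff {k : Type*} [Field k] {u : k} (hu : u ≠ 0) (x : k) :
    IsSquare (u ^ 2 * x) ↔ IsSquare x := by
  refine ⟨fun ⟨r, hr⟩ ↦ ⟨r * u⁻¹, ?_⟩, fun ⟨r, hr⟩ ↦ ⟨u * r, by rw [hr]; ring⟩⟩
  field_simp
  linear_combination hr

variable [NeZero (2 : K)] {X : WeierstrassCurve K} [IsMinimal R X] {d : Rˣ}
  [IsMinimal R (X.quadraticTwist (algebraMap R K d))]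

/-- The image of `w⁻¹` (`w = 2`) in the residue field is `2⁻¹`, and `2 ≠ 0` there. [folklore] -/
theorem residue_units_inv_two {w : Rˣ} (hw : (w : R) = 2) :
    (2 : ResidueField R) ≠ 0 ∧ residue R ((w⁻¹ : Rˣ) : R) = (2 : ResidueField R)⁻¹ := by
  have h2 : residue R (w : R) = 2 := by rw [hw, map_ofNat]
  have hne : (2 : ResidueField R) ≠ 0 := h2 ▸ residue_units_ne_zero R w
  exact ⟨hne, by rw [← h2]; exact map_units_inv (residue R) w⟩

/-- **Split multiplicative reduction of a unit twist** (odd residue characteristic, finite residue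
field): if `X` (minimal) has multiplicative reduction, then `X^{(d)}` has *split* multiplicative
reduction iff (`d̄` is a square in `k` ↔ `X` has split multiplicative reduction). The node-tangent
discriminants are `−c₄c₆ ≠ 0` for `X` and `d⁵ · (−c₄ c₆)` for the twist (Silverman, *AEC* VII.5,
Definition; Exercise 10.16 for the classical statement on `a_p`). [folklore] -/
theorem hasSplitMultiplicativeReduction_quadraticTwist_iff [Finite (ResidueField R)]
    (h2 : IsUnit (2 : R)) (hmult : X.HasMultiplicativeReduction R) :
    (X.quadraticTwist (algebraMap R K d)).HasSplitMultiplicativeReduction R ↔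
      (IsSquare (residue R (d : R)) ↔ X.HasSplitMultiplicativeReduction R) := by
  obtain ⟨w, hw⟩ := h2
  obtain ⟨h2k, he⟩ := residue_units_inv_two R hw
  haveI : NeZero (2 : ResidueField R) := ⟨h2k⟩
  haveI : IsIntegral R (X.quadraticTwist (algebraMap R K d)) := inferInstance
  have hint := integralModel_quadraticTwist R X w hw (d : R)
  have hYmult : (X.quadraticTwist (algebraMap R K d)).HasMultiplicativeReduction R :=
    (hasMultiplicativeReduction_quadraticTwist_iff R).mpr hmult
  set I := X.integralModel R with hI
  set φ := residue R with hφ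
  have halg : algebraMap R (ResidueField R) = φ := IsLocalRing.ResidueField.algebraMap_eq R
  have hd0 : φ d ≠ 0 := residue_units_ne_zero R d
  -- the reduced invariants of `X`
  have hc₄ : φ I.c₄ ≠ 0 := by
    intro h
    have h1 := hmult.multiplicativeReduction
    rw [← integralModel_c₄_eq R X, valuation_eq_one_iff_notMem] at h1
    exact h1 ((residue_eq_zero_iff _).mp h)
  have hΔ : φ I.Δ = 0 := by
    have h1 := hmult.badReduction
    rw [← integralModel_Δ_eq R X, valuation_lt_one_iff_mem] at h1
    exact (residue_eq_zero_iff _).mpr h1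
  have hc₆ : φ I.c₆ ≠ 0 := by
    intro h
    have hrel := congrArg φ I.c_relation
    rw [map_mul, hΔ, mul_zero, map_sub, map_pow, map_pow, h, zero_pow two_ne_zero, sub_zero] at hrel
    exact pow_ne_zero 3 hc₄ hrel.symm
  have hmapdisc : ∀ a b c : R, φ (discrim a b c) = discrim (φ a) (φ b) (φ c) := fun a b c ↦ by
    simp only [discrim, map_sub, map_mul, map_pow, map_ofNat]
  have hdisc : discrim (φ I.c₄) (φ (I.a₁ * I.c₄)) (φ (-(54 * I.b₆ - 3 * I.b₂ * I.b₄ + I.a₂ * I.c₄))) =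
      -(φ I.c₄ * φ I.c₆) := by
    rw [← hmapdisc, discrim_nodalTangents, map_neg, map_mul]
  have hdisc0 : -(φ I.c₄ * φ I.c₆) ≠ 0 := neg_ne_zero.mpr (mul_ne_zero hc₄ hc₆)
  -- `X` is split iff `-c₄ c₆` is a square in `k`
  have hXsplit : X.HasSplitMultiplicativeReduction R ↔ IsSquare (-(φ I.c₄ * φ I.c₆)) := by
    have hpoly : (Polynomial.map (algebraMap R (ResidueField R)) (C I.c₄ * Polynomial.X ^ 2 +
        C (I.a₁ * I.c₄) * Polynomial.X - C (54 * I.b₆ - 3 * I.b₂ * I.b₄ + I.a₂ * I.c₄))).Splits ↔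
        IsSquare (-(φ I.c₄ * φ I.c₆)) := by
      simp only [Polynomial.map_sub, Polynomial.map_add, Polynomial.map_mul, Polynomial.map_pow,
        Polynomial.map_C, Polynomial.map_X, halg]
      rw [sub_eq_add_neg, ← C_neg, ← map_neg, splits_quadratic_iff_isSquare_discrim hc₄, hdisc]
    rw [hasSplitMultiplicativeReduction_iff]
    exact ⟨fun ⟨_, hs⟩ ↦ hpoly.mp hs, fun hs ↦ ⟨hmult, hpoly.mpr hs⟩⟩
  -- the explicit integral model of the twist and its node-tangent polynomial
  set I' : WeierstrassCurve R := ⟨0, (d : R) * I.b₂ * ↑w⁻¹ * ↑w⁻¹, 0, (d : R) ^ 2 * I.b₄ * ↑w⁻¹,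
    (d : R) ^ 3 * I.b₆ * ↑w⁻¹ * ↑w⁻¹⟩ with hI'
  have hlead : φ I'.c₄ = φ d ^ 2 * φ I.c₄ := by
    simp only [hI', c₄, b₂, b₄, map_sub, map_add, map_mul, map_pow, map_ofNat, map_zero, he]
    field_simp
    ring
  have hlead0 : φ I'.c₄ ≠ 0 := by
    rw [hlead]
    exact mul_ne_zero (pow_ne_zero 2 hd0) hc₄
  have hdisc' : discrim (φ I'.c₄) (φ (I'.a₁ * I'.c₄))
      (φ (-(54 * I'.b₆ - 3 * I'.b₂ * I'.b₄ + I'.a₂ * I'.c₄))) =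
      (φ d ^ 2) ^ 2 * (φ d * -(φ I.c₄ * φ I.c₆)) := by
    simp only [hI', discrim, c₄, c₆, b₂, b₄, b₆, map_sub, map_add, map_mul, map_pow, map_ofNat,
      map_zero, map_neg, he]
    field_simp
    ring
  have hpolyY : (Polynomial.map (algebraMap R (ResidueField R)) (C I'.c₄ * Polynomial.X ^ 2 +
      C (I'.a₁ * I'.c₄) * Polynomial.X -
        C (54 * I'.b₆ - 3 * I'.b₂ * I'.b₄ + I'.a₂ * I'.c₄))).Splits ↔
      IsSquare (φ d * -(φ I.c₄ * φ I.c₆)) := by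
    simp only [Polynomial.map_sub, Polynomial.map_add, Polynomial.map_mul, Polynomial.map_pow,
      Polynomial.map_C, Polynomial.map_X, halg]
    rw [sub_eq_add_neg, ← C_neg, ← map_neg, splits_quadratic_iff_isSquare_discrim hlead0, hdisc',
      isSquare_mul_sq_iff (pow_ne_zero 2 hd0)]
  rw [hasSplitMultiplicativeReduction_iff]
  constructor
  · rintro ⟨h1, hs⟩
    rw [hint] at hs
    exact ((isSquare_mul_iff_of_finite hd0 hdisc0).mp (hpolyY.mp hs)).trans hXsplit.symm
  · intro h
    refine ⟨hYmult, ?_⟩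
    rw [hint]
    exact hpolyY.mpr ((isSquare_mul_iff_of_finite hd0 hdisc0).mpr (h.trans hXsplit))

end Split

/-! ### Good reduction: the reduction of the twist is the twist of the reduction -/

section Good

variable [NeZero (2 : K)] {X : WeierstrassCurve K} [IsMinimal R X] {d : Rˣ}
  [IsMinimal R (X.quadraticTwist (algebraMap R K d))]

omit [NeZero (2 : K)] in
/-- **The reduction of a unit twist is the twist of the reduction**: with the integral model of
`baseChange_twistLift`, `(X^{(d)})~ = (X̃)^{(d̄)}` over the residue field (`2 ∈ Rˣ`). [folklore] -/
theorem reduction_quadraticTwist (h2 : IsUnit (2 : R)) :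
    (X.quadraticTwist (algebraMap R K d)).reduction R = (X.reduction R).quadraticTwist (residue R d) := by
  obtain ⟨w, hw⟩ := h2
  obtain ⟨h2k, he⟩ := residue_units_inv_two R hw
  have h4k : (4 : ResidueField R) ≠ 0 := by
    rw [show (4 : ResidueField R) = 2 * 2 by norm_num]
    exact mul_ne_zero h2k h2k
  haveI : IsIntegral R (X.quadraticTwist (algebraMap R K d)) := inferInstance
  rw [reduction, reduction, integralModel_quadraticTwist R X w hw (d : R)]
  ext
  · simp
  · simp only [map_a₂, quadraticTwist_a₂, map_b₂, map_mul, he]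
    field_simp
    norm_num
  · simp
  · simp only [map_a₄, quadraticTwist_a₄, map_b₄, map_mul, map_pow, he]
    field_simp
  · simp only [map_a₆, quadraticTwist_a₆, map_b₆, map_mul, map_pow, he]
    field_simp
    norm_num

omit [NeZero (2 : K)] in
/-- **Point count of the reduction of a unit twist at a good place**:
`q + 1 − #X̃^{(d)}(k) = χ(d̄) · (q + 1 − #X̃(k))`, `χ(d̄) = 1` if `d̄` is a square in `k` and `−1`
otherwise (Knapp, *Elliptic Curves*, Prop. 12.10; the tree's
`card_add_one_sub_natCard_point_quadraticTwist` applied to `X̃ / k`).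
[cite: Knapp1993, Prop. 12.10 (PDF pp. 302–303)] -/
theorem card_sub_natCard_point_reduction_quadraticTwist [Finite (ResidueField R)]
    (h2 : IsUnit (2 : R)) (hgood : X.HasGoodReduction R) :
    (Nat.card (ResidueField R) : ℤ) + 1 -
        Nat.card ((X.quadraticTwist (algebraMap R K d)).reduction R).toAffine.Point =
      (if IsSquare (residue R (d : R)) then 1 else -1) *
        ((Nat.card (ResidueField R) : ℤ) + 1 - Nat.card (X.reduction R).toAffine.Point) := by
  haveI := Fintype.ofFinite (ResidueField R)
  obtain ⟨w, hw⟩ := id h2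
  obtain ⟨h2k, -⟩ := residue_units_inv_two R hw
  haveI : NeZero (2 : ResidueField R) := ⟨h2k⟩
  haveI : (X.reduction R).IsElliptic := (hasGoodReduction_iff_isElliptic_reduction R).mp hgood
  have hd0 : residue R (d : R) ≠ 0 := residue_units_ne_zero R d
  rw [reduction_quadraticTwist R h2, Nat.card_eq_fintype_card,
    card_add_one_sub_natCard_point_quadraticTwist (X.reduction R) hd0]
  congr 1
  split_ifs with hsq
  · exact_mod_cast (quadraticChar_one_iff_isSquare hd0).mpr hsq
  · exact_mod_cast quadraticChar_neg_one_iff_not_isSquare.mpr hsq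

end Good

/-! ### The local polynomial and the local Euler factor of the twist -/

section LocalPolynomial

variable [Finite (ResidueField R)]

omit [Finite (ResidueField R)] in
/-- For a *minimal* equation `Y` of an elliptic curve, Mathlib's `localPolynomial` (defined on the
chosen minimal model `Y.minimal R`) may be computed on `Y` itself: the two minimal equations are
`K`-isomorphic, so reduction type and point count agree (Silverman, *AEC* VII.1 Prop. 1.3(b),
VII.5 Prop. 5.1; the tree's `…_iff_of_isMinimal_of_eq_smul` lemmas). [folklore] -/
theorem localPolynomial_eq_of_isMinimal (Y : WeierstrassCurve K) [IsMinimal R Y] [Y.IsElliptic] :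
    Y.localPolynomial R =
      if Y.HasGoodReduction R then
        1 - Polynomial.C ((Nat.card (ResidueField R) : ℤ) + 1 -
            Nat.card (Y.reduction R).toAffine.Point) * Polynomial.X +
          Polynomial.C (Nat.card (ResidueField R) : ℤ) * Polynomial.X ^ 2
      else if Y.HasSplitMultiplicativeReduction R then 1 - Polynomial.X
      else if Y.HasMultiplicativeReduction R then 1 + Polynomial.X else 1 := by
  have h1 : Y.minimal R = (Y.exists_isMinimal R).choose • Y := rfl
  have hΔ : Y.Δ ≠ 0 := Y.isUnit_Δ.ne_zero
  unfold localPolynomial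
  simp only [hasGoodReduction_iff_of_isMinimal_of_eq_smul R h1,
    hasSplitMultiplicativeReduction_iff_of_isMinimal_of_eq_smul R h1 hΔ,
    hasMultiplicativeReduction_iff_of_isMinimal_of_eq_smul R h1 hΔ,
    natCard_point_reduction_eq_of_isMinimal_of_eq_smul R h1 hΔ]

/-- **The local polynomial of a unit quadratic twist** (DVR with finite residue field of odd
characteristic, `d ∈ Rˣ`): if `L_v(X, T) = 1 − A T + B T²` is Mathlib's local polynomial of the
elliptic curve `X / K` then `L_v(X^{(d)}, T) = 1 − χ(d̄) A T + B T²`, where `χ(d̄) = 1` if the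
residue `d̄` is a square in `k` and `−1` otherwise — i.e. `a ↦ χ(d̄) a` at a good place
(Knapp, *Elliptic Curves*, Prop. 12.10; Silverman, *AEC* Exercise 10.16), split ↔ non-split
exchanged at a multiplicative place exactly when `d̄` is a non-square, and `1 ↦ 1` at an additive
place. [folklore] -/
theorem localPolynomial_quadraticTwist (h2 : IsUnit (2 : R)) (X : WeierstrassCurve K) [X.IsElliptic]
    (d : Rˣ) :
    ∃ A B : ℤ, X.localPolynomial R = 1 - Polynomial.C A * Polynomial.X + Polynomial.C B * Polynomial.X ^ 2 ∧
      (X.quadraticTwist (algebraMap R K d)).localPolynomial R =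
        1 - Polynomial.C ((if IsSquare (residue R (d : R)) then 1 else -1) * A) * Polynomial.X +
          Polynomial.C B * Polynomial.X ^ 2 := by
  haveI : NeZero (2 : K) := ⟨two_ne_zero_of_isUnit_two R h2⟩
  -- reduce to the chosen minimal model `Xm` of `X`
  set Xm := X.minimal R with hXm
  haveI : Xm.IsElliptic := isElliptic_minimal R X
  have hX : X = ((X.exists_isMinimal R).choose)⁻¹ • Xm := (inv_smul_smul _ X).symm
  haveI : (Xm.quadraticTwist (algebraMap R K d)).IsElliptic :=
    Xm.isElliptic_quadraticTwist (algebraMap_units_ne_zero R d)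
  have hlpX : X.localPolynomial R = Xm.localPolynomial R := by
    conv_lhs => rw [hX]
    exact localPolynomial_smul R Xm _
  have hlpY : (X.quadraticTwist (algebraMap R K d)).localPolynomial R =
      (Xm.quadraticTwist (algebraMap R K d)).localPolynomial R := by
    conv_lhs => rw [hX]
    rw [quadraticTwist_smul]
    exact localPolynomial_smul R _ _
  haveI : IsMinimal R (Xm.quadraticTwist (algebraMap R K d)) := isMinimal_quadraticTwist R Xm h2 d
  rw [hlpX, hlpY, localPolynomial_eq_of_isMinimal R Xm,
    localPolynomial_eq_of_isMinimal R (Xm.quadraticTwist (algebraMap R K d))]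
  simp only [hasGoodReduction_quadraticTwist_iff R, hasMultiplicativeReduction_quadraticTwist_iff R]
  by_cases hg : Xm.HasGoodReduction R
  · refine ⟨(Nat.card (ResidueField R) : ℤ) + 1 - Nat.card (Xm.reduction R).toAffine.Point,
      Nat.card (ResidueField R), by rw [if_pos hg], ?_⟩
    rw [if_pos hg, card_sub_natCard_point_reduction_quadraticTwist R h2 hg]
  by_cases hm : Xm.HasMultiplicativeReduction R
  · rw [if_neg hg, if_neg hg, hasSplitMultiplicativeReduction_quadraticTwist_iff R h2 hm, if_pos hm]
    by_cases hs : Xm.HasSplitMultiplicativeReduction R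
    · refine ⟨1, 0, by rw [if_pos hs]; simp, ?_⟩
      by_cases hsq : IsSquare (residue R (d : R))
      · rw [if_pos (iff_of_true hsq hs), if_pos hsq]
        simp
      · rw [if_neg (fun h ↦ hsq (h.mpr hs)), if_neg hsq]
        simp
    · refine ⟨-1, 0, by rw [if_neg hs]; simp, ?_⟩
      by_cases hsq : IsSquare (residue R (d : R))
      · rw [if_neg (fun h ↦ hs (h.mp hsq)), if_pos hsq]
        simp
      · rw [if_pos (iff_of_false hsq hs), if_neg hsq]
        simp
  · have hs : ¬ Xm.HasSplitMultiplicativeReduction R := fun h ↦ hm h.toHasMultiplicativeReduction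
    have hs' : ¬ (Xm.quadraticTwist (algebraMap R K d)).HasSplitMultiplicativeReduction R := fun h ↦
      hm ((hasMultiplicativeReduction_quadraticTwist_iff R).mp h.toHasMultiplicativeReduction)
    refine ⟨0, 0, by rw [if_neg hg, if_neg hs, if_neg hm]; simp, ?_⟩
    rw [if_neg hg, if_neg hs', if_neg hm]
    simp

omit [IsDomain R] [IsDiscreteValuationRing R] [Finite (ResidueField R)] in
/-- As power series, `1 − sA T + B T²` is the rescaling `T ↦ sT` of `1 − A T + B T²` when `s² = 1`.
[folklore] -/
theorem coe_quadratic_eq_rescale (A B s : ℤ) (hs : s * s = 1) :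
    ((1 - Polynomial.C (s * A) * Polynomial.X + Polynomial.C B * Polynomial.X ^ 2 : ℤ[X]) :
        PowerSeries ℤ) =
      PowerSeries.rescale s
        ((1 - Polynomial.C A * Polynomial.X + Polynomial.C B * Polynomial.X ^ 2 : ℤ[X]) :
          PowerSeries ℤ) := by
  ext n
  simp only [Polynomial.coeff_coe, PowerSeries.coeff_rescale, Polynomial.coeff_add,
    Polynomial.coeff_sub, Polynomial.coeff_one, Polynomial.coeff_C_mul, Polynomial.coeff_X_pow,
    Polynomial.coeff_X]
  rcases n with _ | _ | _ | n
  · simp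
  · simp
  · simp [sq, hs]
  · simp

omit [IsDomain R] [IsDiscreteValuationRing R] [Finite (ResidueField R)] in
/-- Inverting a power series with constant coefficient `1` commutes with the rescaling `T ↦ sT`
(both sides are inverses of the rescaled series). [folklore] -/
theorem invOfUnit_rescale {S : Type*} [CommRing S] (φ : PowerSeries S)
    (hφ : PowerSeries.constantCoeff φ = 1) (s : S) :
    PowerSeries.invOfUnit (PowerSeries.rescale s φ) 1 =
      PowerSeries.rescale s (PowerSeries.invOfUnit φ 1) := by
  have h0 : PowerSeries.constantCoeff (PowerSeries.rescale s φ) = ((1 : Sˣ) : S) := by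
    rw [← PowerSeries.coeff_zero_eq_constantCoeff_apply, PowerSeries.coeff_rescale, pow_zero, one_mul,
      PowerSeries.coeff_zero_eq_constantCoeff_apply, hφ, Units.val_one]
  have h1 : PowerSeries.rescale s φ * PowerSeries.invOfUnit (PowerSeries.rescale s φ) 1 = 1 :=
    PowerSeries.mul_invOfUnit _ _ h0
  have h2 : PowerSeries.rescale s φ * PowerSeries.rescale s (PowerSeries.invOfUnit φ 1) = 1 := by
    rw [← map_mul, PowerSeries.mul_invOfUnit φ 1 (by rw [hφ, Units.val_one]), map_one]
  calc PowerSeries.invOfUnit (PowerSeries.rescale s φ) 1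
      = PowerSeries.invOfUnit (PowerSeries.rescale s φ) 1 *
          (PowerSeries.rescale s φ * PowerSeries.rescale s (PowerSeries.invOfUnit φ 1)) := by
        rw [h2, mul_one]
    _ = (PowerSeries.rescale s φ * PowerSeries.invOfUnit (PowerSeries.rescale s φ) 1) *
          PowerSeries.rescale s (PowerSeries.invOfUnit φ 1) := by ring
    _ = PowerSeries.rescale s (PowerSeries.invOfUnit φ 1) := by rw [h1, one_mul]

/-- **The inverted local factor of a unit quadratic twist is the rescaling by `χ(d̄)`**:
`1/L_v(X^{(d)}, T) = (1/L_v(X, ·))(χ(d̄) T)` as power series (from `localPolynomial_quadraticTwist`).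
[folklore] -/
theorem localPowerSeries_quadraticTwist (h2 : IsUnit (2 : R)) (X : WeierstrassCurve K) [X.IsElliptic]
    (d : Rˣ) :
    (X.quadraticTwist (algebraMap R K d)).localPowerSeries R =
      PowerSeries.rescale (if IsSquare (residue R (d : R)) then 1 else -1 : ℤ) (X.localPowerSeries R) := by
  obtain ⟨A, B, hX, hY⟩ := localPolynomial_quadraticTwist R h2 X d
  have hs : (if IsSquare (residue R (d : R)) then 1 else -1 : ℤ) *
      (if IsSquare (residue R (d : R)) then 1 else -1 : ℤ) = 1 := by
    split_ifs <;> norm_num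
  have hφ : PowerSeries.constantCoeff ((1 - Polynomial.C A * Polynomial.X +
      Polynomial.C B * Polynomial.X ^ 2 : ℤ[X]) : PowerSeries ℤ) = 1 := by
    rw [← PowerSeries.coeff_zero_eq_constantCoeff_apply, Polynomial.coeff_coe]
    simp
  rw [localPowerSeries, localPowerSeries, hY, hX, coe_quadratic_eq_rescale A B _ hs,
    invOfUnit_rescale _ hφ]

/-- **The local Euler factor of a unit quadratic twist**: Mathlib's
`localEulerFactor = (1/L_v)(q_v^{-s})` of `X^{(d)}` is obtained from that of `X` by rescaling the
inverted local factor by `χ(d̄)`, i.e. its coefficient at `q_v^i` is `χ(d̄)^i` times that of `X`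
("`a_𝔭(E ⊗ χ) = χ(𝔭) a_𝔭(E)`", Silverman *AEC* Exercise 10.16, in Euler-factor form). [folklore] -/
theorem localEulerFactor_quadraticTwist (h2 : IsUnit (2 : R)) (X : WeierstrassCurve K) [X.IsElliptic]
    (d : Rˣ) :
    (X.quadraticTwist (algebraMap R K d)).localEulerFactor R =
      ArithmeticFunction.ofPowerSeries (Nat.card (ResidueField R))
        (PowerSeries.rescale (if IsSquare (residue R (d : R)) then 1 else -1 : ℤ)
          (X.localPowerSeries R)) := by
  rw [localEulerFactor, localPowerSeries_quadraticTwist R h2 X d]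

end LocalPolynomial

end WeierstrassCurve

end
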